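import Summits.BirchSwinnertonDyer.BirchSwinnertonDyer.Theorems.TwoAdicConverseIsoT1Defs
import Summits.BirchSwinnertonDyer.BirchSwinnertonDyer.Theorems.TwoAdicConverseIsoT1OfMazurKenku
import HarnessLib

set_option linter.dupNamespace false -- `…BirchSwinnertonDyer.BirchSwinnertonDyer…` is the cell's nested layout (D-0017)
set_option autoImplicit false

/-!
# (ISO-T₁) BY NAME: `isoT1AtTwo_of_not_hasCM` and item 19218 from `∀ W, IsoT1AtTwo W`

Cell `bsd-2adic` (run/shared/lean/pub/bsd-2adic/), seat `bsd-2adic-tower-1` GEN 37 (SUMMON RC-513/RC-515 key «`IsoT1AtTwo` def +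
`isoT1AtTwo_of_not_hasCM` via road K»).  THEOREMS ONLY (no definition, no named fact, no instance, no `sorry`);
`--supports stmt-BirchSwinnertonDyer-19218`.  The mathematics is in `…TwoAdicConverseIsoT1Transport` / `…TwoAdicConverseIsoT1OfMazurKenku`;
this file only states it through the predicate `TwoAdicEulerCharKernel.IsoT1AtTwo` (`…TwoAdicConverseIsoT1Defs`) so that consumers cite ONE
name.  HONEST FRAMING: item 19218 stays OPEN (crux `OrdLambdaHalfAtTwo`); PRINT inputs modularity, Kato 17.4 (1)(2)@2, Mazur–Kenku are
hypotheses; nothing is booked; BSD is not proved by any of this.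

* `isoT1AtTwo_of_not_hasCM (hMK) (W) (hcm) (hgo) : IsoT1AtTwo W` — every non-CM globally minimal `E/ℚ` good ordinary at `2` satisfies
  (ISO-T₁) (the parity clause «`2 ∣ #E(ℚ)_tors`» of the displayed hypothesis is not needed; `…_of_two_dvd_torsionOrder` records the
  displayed shape); `forall_isoT1AtTwo_of_mazurKenku` — the class-level statement (ISO-T₁)∣(β) verbatim.
* `goodOrdinaryRankZeroTwoConverse_of_ordLambdaHalfAtTwo_of_forall_isoT1AtTwo (hmod) (h17) (hΛ) (hISO)` — p749231's composition with
  `hISO` spelled `∀ W, … → IsoT1AtTwo W`; `goodOrdinaryRankZeroTwoConverse_of_ordLambdaHalfAtTwo_of_mazurKenku'` — with `hISO` discharged.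

References: [SilvermanAEC2009] IX.6 Example 6.4; [Mazur1978] Thm. 1; [Kenku1982]; [GreenbergLNM1716] Thm. 4.1, §5 p. 123;
[Kato2004Asterisque] Thm. 17.4.
-/

noncomputable section

open scoped Classical NumberField

open NumberField IsDedekindDomain WeierstrassCurve Literature.NumberTheory.EllipticCurves
  Literature.NumberTheory.EllipticCurves.ModularForms
open Summit.BirchSwinnertonDyer.BirchSwinnertonDyer.Theses.TwoAdicConverse (OrdLambdaHalfAtTwo GoodOrdinaryRankZeroTwoConverse)

namespace Summit.BirchSwinnertonDyer.BirchSwinnertonDyer.Theorems.TwoAdicEulerCharKernel.IsoT1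

/-- ★ **(ISO-T₁) for every non-CM good-ordinary-at-`2` curve, by name.**  `E/ℚ` globally minimal, `End_{ℚ̄}(E) = ℤ`, good ordinary
reduction at `2`; Mazur–Kenku (`mazurKenku_exists_cyclic_isogeny`) ⟹ `IsoT1AtTwo W` (road K: `exists_isIsogenous_T1_of_mazurKenku`).
[cite: SilvermanAEC2009, IX.6 Example 6.4] [cite: Mazur1978, Thm. 1] [cite: Kenku1982] [cite: GreenbergLNM1716, §5 p. 123] -/
theorem isoT1AtTwo_of_not_hasCM (hMK : mazurKenku_exists_cyclic_isogeny) (W : WeierstrassCurve ℚ) [W.IsElliptic]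
    [W.IsGloballyMinimal] (hcm : ¬ W.HasCM) (hgo : Rank1Residual.GoodOrd W 2) : IsoT1AtTwo W :=
  (isoT1AtTwo_iff W).mpr (exists_isIsogenous_T1_of_mazurKenku hMK W hcm hgo)

/-- The displayed shape of p749231's `hISO` (with its parity clause, unused). [cite: SilvermanAEC2009, IX.6 Example 6.4] [cite: Mazur1978, Thm. 1] -/
theorem isoT1AtTwo_of_not_hasCM_of_two_dvd_torsionOrder (hMK : mazurKenku_exists_cyclic_isogeny) (W : WeierstrassCurve ℚ)
    [W.IsElliptic] [W.IsGloballyMinimal] (hcm : ¬ W.HasCM) (hgo : Rank1Residual.GoodOrd W 2) (_h2 : 2 ∣ W.torsionOrder) :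
    IsoT1AtTwo W :=
  isoT1AtTwo_of_not_hasCM hMK W hcm hgo

/-- **(ISO-T₁)∣(β), class level, verbatim the hypothesis of p749231 with `IsoT1AtTwo`.** [cite: SilvermanAEC2009, IX.6 Example 6.4]
[cite: Mazur1978, Thm. 1] [cite: Kenku1982] -/
theorem forall_isoT1AtTwo_of_mazurKenku (hMK : mazurKenku_exists_cyclic_isogeny) :
    ∀ (W : WeierstrassCurve ℚ) [W.IsElliptic] [W.IsGloballyMinimal], ¬ W.HasCM → Rank1Residual.GoodOrd W 2 →
      2 ∣ W.torsionOrder → IsoT1AtTwo W :=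
  fun W _ _ hcm hgo _ ↦ isoT1AtTwo_of_not_hasCM hMK W hcm hgo

/-- **Item 19218 from `∀ W, … → IsoT1AtTwo W`** (p749231's `goodOrdinaryRankZeroTwoConverse_of_ordLambdaHalfAtTwo_of_isoT1`, `hISO` by
name). [cite: GreenbergLNM1716, Thm. 4.1 (p. 102)] [cite: Kato2004Asterisque, Thm. 17.4 (1)(2) (p. 273)] -/
theorem goodOrdinaryRankZeroTwoConverse_of_ordLambdaHalfAtTwo_of_forall_isoT1AtTwo
    (hmod : nonempty_modularParametrizationData)
    (h17 : ∀ (W : WeierstrassCurve ℚ) [W.IsElliptic] [W.IsGloballyMinimal]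
      [NeZero (W.conductorNorm ℤ)] (f : CuspForm (CongruenceSubgroup.Gamma0 (W.conductorNorm ℤ)) 2),
      kato_divisibility_allPrimes W 2 (f := f))
    (hΛ : OrdLambdaHalfAtTwo)
    (hISO : ∀ (W : WeierstrassCurve ℚ) [W.IsElliptic] [W.IsGloballyMinimal], ¬ W.HasCM → Rank1Residual.GoodOrd W 2 →
      2 ∣ W.torsionOrder → IsoT1AtTwo W) :
    GoodOrdinaryRankZeroTwoConverse :=
  goodOrdinaryRankZeroTwoConverse_of_ordLambdaHalfAtTwo_of_isoT1 hmod h17 hΛ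
    fun W _ _ hcm hgo h2 ↦ (isoT1AtTwo_iff W).mp (hISO W hcm hgo h2)

/-- **Item 19218 modulo PRINT {modularity, Kato 17.4 (1)(2)@2, Mazur–Kenku} and the crux `OrdLambdaHalfAtTwo`** — the composition of the
two theorems above (same statement as `goodOrdinaryRankZeroTwoConverse_of_ordLambdaHalfAtTwo_of_mazurKenku` of the sibling file, routed
through the predicate). [cite: SilvermanAEC2009, IX.6 Example 6.4] [cite: Kato2004Asterisque, Thm. 17.4 (1)(2) (p. 273)] -/
theorem goodOrdinaryRankZeroTwoConverse_of_ordLambdaHalfAtTwo_of_mazurKenku'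
    (hmod : nonempty_modularParametrizationData)
    (h17 : ∀ (W : WeierstrassCurve ℚ) [W.IsElliptic] [W.IsGloballyMinimal]
      [NeZero (W.conductorNorm ℤ)] (f : CuspForm (CongruenceSubgroup.Gamma0 (W.conductorNorm ℤ)) 2),
      kato_divisibility_allPrimes W 2 (f := f))
    (hΛ : OrdLambdaHalfAtTwo) (hMK : mazurKenku_exists_cyclic_isogeny) :
    GoodOrdinaryRankZeroTwoConverse :=
  goodOrdinaryRankZeroTwoConverse_of_ordLambdaHalfAtTwo_of_forall_isoT1AtTwo hmod h17 hΛ (forall_isoT1AtTwo_of_mazurKenku hMK)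

end Summit.BirchSwinnertonDyer.BirchSwinnertonDyer.Theorems.TwoAdicEulerCharKernel.IsoT1

end
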